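import Literature.NumberTheory.EllipticCurves.PAdicOneVariableRelNormCoherentUnitsOfGlobal
import Literature.NumberTheory.NumberFields.RayClassTowerGlobalUnits
import HarnessLib

/-!
# `p`-adic CM assembly at the split prime `v`: the `𝔓`-COMPONENT MAP from the `Γ_K`-monoid of global
# norm-coherent units to the `𝔓`-adic units `𝒰_𝔓` — a monoid map, `Gal(K̄/K(𝔪))`-equivariant
# (de Shalit 1987, II.4.1 (2) `Φ = ⊕_𝔓 F_𝔓`, II.4.9 (23)–(24), I.3.4)

Topic `NumberTheory/EllipticCurves`; namespace `Literature.NumberTheory.EllipticCurves`.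

Sequel of `PAdicOneVariableRelNormCoherentUnitsOfGlobal.lean` (`RelNormCoherentUnits.ofGlobal`: a norm-coherent sequence
of global units `x_m ∈ K(𝔪v^{m+1})`, given as RAW data with side conditions, read in `𝒰_𝔓 = RelNormCoherentUnits hπ E`
through `ι : K̄ → K̄_v`; multiplicative; `Gal(K̄/K(𝔪))`-equivariant for the `κ_v`-action `rayAction`) and of
`RayClassTowerGlobalUnits.lean` (the same sequences BUNDLED as a commutative monoid `GlobalNormCoherentUnits h𝔪 v` with
its `Γ_K`-action `galAction`).  THIS file is the dictionary between the two — the `𝔓`-component projection of de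
Shalit's semi-local `𝒰 = ∏_𝔓 𝒰_𝔓` restricted to the global (diagonally embedded) units:

* `RelNormCoherentUnits.ofGlobalUnits … x := ofGlobal … x.val …` and `coe_val_ofGlobalUnits` (components `ι(x_m)`);
* ★ `ofGlobalUnits_mul`, `ofGlobalUnits_one`, `ofGlobalUnits_pow` — a MONOID MAP;
* ★★ `rayAction_smul_ofGlobalUnits` — **`g • ofGlobalUnits x = ofGlobalUnits (g • x)` for `g ∈ Gal(K̄/K(𝔪))`**: the
  `κ_v`-action on `𝒰_𝔓` is the restriction of the `Γ_K`-action on the global units (the `H`-equivariance feeding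
  `GroupDistribution.induceFrom`, `ProfiniteGroupDistributionInduceFromSubgroup.lean`, with `H = Gal(K̄/K(𝔪)) ≤ Γ_K`).

One definition with body (`ofGlobalUnits`, a specialisation of `ofGlobal`); theorems otherwise; the monoid / action
structures of the sibling files are enabled section-locally exactly as there; no named facts, no global instances, no `sorry`.

## References
* [deShalit1987] E. de Shalit, *Iwasawa theory of elliptic curves with complex multiplication* (1987), II.4.1 (2)–(3)
  (p. 56), II.4.9 (23)–(24) (p. 62), I.3.4 (p. 18), II.1.10 Corollary (p. 39).
-/

noncomputable section

open MvPowerSeries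

namespace Literature.NumberTheory.EllipticCurves

section OfGlobalMonoid

open NumberField IsDedekindDomain IsDedekindDomain.HeightOneSpectrum Field ValuativeRel IsLocalRing
open Literature.NumberTheory.GaloisRepresentations Literature.NumberTheory.GaloisRepresentations.IsNonarchimedeanLocalField
  Literature.NumberTheory.GaloisRepresentations.LubinTate Literature.NumberTheory.PAdicHodge
  Literature.NumberTheory.GaloisRepresentations.ArtinLocalGlobal Literature.NumberTheory.NumberFields

variable {K : Type} [Field K] [NumberField K] {𝔪 : Ideal (𝓞 K)} {v : HeightOneSpectrum (𝓞 K)}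

attribute [local instance] ltNormUniformSpace ltNormIsUniformAddGroup rk1 nF nE fintypeResidueField
attribute [local instance] RelNormCoherentUnits.instCommMonoid GlobalNormCoherentUnits.instCommMonoid
  GlobalNormCoherentUnits.galAction

variable [IsTotallyComplex K]
  (h𝔪 : 𝔪 ≠ ⊥) (hv : ¬ 𝔪 ≤ v.asIdeal) (hw : ∀ u : (𝓞 K)ˣ, (u : 𝓞 K) - 1 ∈ 𝔪 → u = 1)
  {π : 𝒪[v.adicCompletion K]} (hπ : (valuation (v.adicCompletion K)).IsUniformizer (π : v.adicCompletion K))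
  {α : 𝓞 K} (hα0 : α ≠ 0) (hα𝔪 : α - 1 ∈ 𝔪) (hαw : ∀ w : HeightOneSpectrum (𝓞 K), w ≠ v → α ∉ w.asIdeal)
  {f : ℕ} (hαπ : ((α : K) : v.adicCompletion K) = (π : v.adicCompletion K) ^ f)
  (E : IntermediateField (v.adicCompletion K) (AlgebraicClosure (v.adicCompletion K)))
  [FiniteDimensional (v.adicCompletion K) E] [IsGalois (v.adicCompletion K) E] (hE : E ≤ maxUnramified (v.adicCompletion K))
  (hdegE : ∀ w : WeilGroup (v.adicCompletion K),
    WeilGroup.toAbsGalois (v.adicCompletion K) w ∈ E.fixingSubgroup → (f : ℤ) ∣ WeilGroup.deg w)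

/-- **The `𝔓`-component of a global norm-coherent unit sequence**: `x ↦ (ι(x_m))_m ∈ 𝒰_𝔓` — `RelNormCoherentUnits.ofGlobal`
applied to the bundled data of `GlobalNormCoherentUnits`. [cite: deShalit1987, II.4.1 (2) (p. 56), II.4.9 (23)–(24) (p. 62)] -/
def _root_.Literature.NumberTheory.GaloisRepresentations.RelNormCoherentUnits.ofGlobalUnits
    (x : GlobalNormCoherentUnits h𝔪 v) : RelNormCoherentUnits hπ E :=
  RelNormCoherentUnits.ofGlobal h𝔪 hv hw hπ hα0 hα𝔪 hαw hαπ E hE hdegE x.val x.ne_zero x.isIntegral x.isIntegral_inv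
    x.coherent

/-- Components of `ofGlobalUnits x` (unfolding): `(ofGlobalUnits x)_m = ι(x_m)`. [cite: deShalit1987, II.4.9 (23)–(24) (p. 62)] -/
theorem coe_val_ofGlobalUnits (x : GlobalNormCoherentUnits h𝔪 v) (m : ℕ) :
    ((((RelNormCoherentUnits.ofGlobalUnits h𝔪 hv hw hπ hα0 hα𝔪 hαw hαπ E hE hdegE x).val m :
        unitBall (E ⊔ ltField π m : IntermediateField (v.adicCompletion K) (AlgebraicClosure (v.adicCompletion K)))) :
        (E ⊔ ltField π m : IntermediateField (v.adicCompletion K) (AlgebraicClosure (v.adicCompletion K)))) :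
      AlgebraicClosure (v.adicCompletion K)) =
      absClosureEmbedding K (v.adicCompletion K) (x.val m) := rfl

/-- `ofGlobalUnits` in terms of `ofGlobal` (unfolding). [cite: deShalit1987, II.4.9 (23)–(24) (p. 62)] -/
theorem ofGlobalUnits_eq (x : GlobalNormCoherentUnits h𝔪 v) :
    RelNormCoherentUnits.ofGlobalUnits h𝔪 hv hw hπ hα0 hα𝔪 hαw hαπ E hE hdegE x =
      RelNormCoherentUnits.ofGlobal h𝔪 hv hw hπ hα0 hα𝔪 hαw hαπ E hE hdegE x.val x.ne_zero x.isIntegral x.isIntegral_inv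
        x.coherent := rfl

/-- ★ **Multiplicativity**: `ofGlobalUnits (x·y) = ofGlobalUnits x · ofGlobalUnits y`. [cite: deShalit1987, II.4.9 (24) (p. 62), I.2.3 (i) (p. 14)] -/
theorem ofGlobalUnits_mul (x y : GlobalNormCoherentUnits h𝔪 v) :
    RelNormCoherentUnits.ofGlobalUnits h𝔪 hv hw hπ hα0 hα𝔪 hαw hαπ E hE hdegE (x * y) =
      RelNormCoherentUnits.ofGlobalUnits h𝔪 hv hw hπ hα0 hα𝔪 hαw hαπ E hE hdegE x *
        RelNormCoherentUnits.ofGlobalUnits h𝔪 hv hw hπ hα0 hα𝔪 hαw hαπ E hE hdegE y :=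
  ofGlobal_mul_eq h𝔪 hv hw hπ hα0 hα𝔪 hαw hαπ E hE hdegE (GlobalNormCoherentUnits.coe_val_mul x y)

/-- `ofGlobalUnits 1 = 1`. [cite: deShalit1987, II.4.9 (24) (p. 62)] -/
theorem ofGlobalUnits_one :
    RelNormCoherentUnits.ofGlobalUnits h𝔪 hv hw hπ hα0 hα𝔪 hαw hαπ E hE hdegE (1 : GlobalNormCoherentUnits h𝔪 v) = 1 :=
  ofGlobal_one_eq h𝔪 hv hw hπ hα0 hα𝔪 hαw hαπ E hE hdegE GlobalNormCoherentUnits.coe_val_one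

/-- `ofGlobalUnits (x^N) = (ofGlobalUnits x)^N`. [cite: deShalit1987, II.4.9 (24) (p. 62)] -/
theorem ofGlobalUnits_pow (x : GlobalNormCoherentUnits h𝔪 v) (N : ℕ) :
    RelNormCoherentUnits.ofGlobalUnits h𝔪 hv hw hπ hα0 hα𝔪 hαw hαπ E hE hdegE (x ^ N) =
      RelNormCoherentUnits.ofGlobalUnits h𝔪 hv hw hπ hα0 hα𝔪 hαw hαπ E hE hdegE x ^ N := by
  induction N with
  | zero => rw [pow_zero, pow_zero, ofGlobalUnits_one]
  | succ N ih => rw [pow_succ, pow_succ, ofGlobalUnits_mul, ih]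

/-- ★★ **EQUIVARIANCE: the `κ_v`-action on `𝒰_𝔓` is the restriction of the `Γ_K`-action on the global units** — for
`g ∈ Gal(K̄/K(𝔪))`, `g • ofGlobalUnits x = ofGlobalUnits (g • x)` (`rayAction` on the left, `galAction` restricted to the
subgroup on the right). [cite: deShalit1987, II.4.9 (24) (p. 62), II.1.10 Corollary (p. 39), I.3.4 (p. 18)] -/
theorem rayAction_smul_ofGlobalUnits (g : ↥(absRestrictNormalHom (rayClassField K 𝔪)).ker) (x : GlobalNormCoherentUnits h𝔪 v) :
    letI := rayAction h𝔪 hv hw hπ E hE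
    g • RelNormCoherentUnits.ofGlobalUnits h𝔪 hv hw hπ hα0 hα𝔪 hαw hαπ E hE hdegE x =
      RelNormCoherentUnits.ofGlobalUnits h𝔪 hv hw hπ hα0 hα𝔪 hαw hαπ E hE hdegE ((g : absoluteGaloisGroup K) • x) :=
  rayAction_smul_ofGlobal_eq_ofGlobal h𝔪 hv hw hπ hα0 hα𝔪 hαw hαπ E hE hdegE g (fun _ ↦ rfl)

/-- The same for the subgroup action `g • x` (Mathlib's action of `↥H` induced from `Γ_K`).
[cite: deShalit1987, II.4.9 (24) (p. 62), I.3.4 (p. 18)] -/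
theorem rayAction_smul_ofGlobalUnits' (g : ↥(absRestrictNormalHom (rayClassField K 𝔪)).ker) (x : GlobalNormCoherentUnits h𝔪 v) :
    letI := rayAction h𝔪 hv hw hπ E hE
    g • RelNormCoherentUnits.ofGlobalUnits h𝔪 hv hw hπ hα0 hα𝔪 hαw hαπ E hE hdegE x =
      RelNormCoherentUnits.ofGlobalUnits h𝔪 hv hw hπ hα0 hα𝔪 hαw hαπ E hE hdegE (g • x) :=
  rayAction_smul_ofGlobalUnits h𝔪 hv hw hπ hα0 hα𝔪 hαw hαπ E hE hdegE g x

end OfGlobalMonoid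

end Literature.NumberTheory.EllipticCurves

end
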